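import Mathlib
import Literature.NumberTheory.Automorphic.HilbertModularFormQExpansion
import Summits.Langlands.Langlands.Theorems.CapacityClassicalityHilbertIntegralOverconvergentIsCongruenceThetaSeedCoeff
import Summits.Langlands.Langlands.Theorems.CapacityClassicalityHilbertIntegralOverconvergentIsCongruenceStubSliceDerivHolomorphic
import Summits.Langlands.Langlands.Theorems.CapacityClassicalityHilbertIntegralOverconvergentIsCongruenceStubQSeriesSliceDeriv
import Summits.Langlands.Langlands.Theorems.CapacityClassicalityHilbertIntegralOverconvergentIsCongruenceFourierKoecher
import Summits.Langlands.Langlands.Theorems.CapacityClassicalityHilbertIntegralOverconvergentIsCongruenceKoecherPrinciple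
import Summits.Langlands.Langlands.Theorems.CapacityClassicalityHilbertIntegralOverconvergentIsCongruenceStubModularFormPeriodic

/-!
# Coordinate derivatives of Hilbert modular forms (line Sketch-ideate-r1-k1, § X, lead part 1)

Lead's helpers for RESHAPE 20 (§ X — the non-parallel supply via Rankin–Cohen brackets) of line Sketch-ideate-r1-k1 of the
crux `HilbertIntegralOverconvergentIsCongruence` (stmt-Langlands-8485).  For a place `σ` of the totally real field `F`, the
derivative of a function on `ℍ^d` in the coordinate `z_σ` is written without new definitions as the slice derivative
`deriv (fun t ↦ f (Function.update z σ t)) (z σ)`.  This file: slices commute with real translations (`tx_update_add`), keep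
`ℍ` (`tx_update_mem_halfSpace`), slice derivatives only see values on `ℍ` (`tx_slice_deriv_congr`) and are `𝓞F`-periodic for
periodic functions (`tx_slice_deriv_periodic`); and the main lemma `tx_deriv_form_data`: for a Hilbert modular form `h`,
`∂_σ h` is holomorphic and `𝓞F`-periodic on `ℍ` with Fourier coefficients `2πi σ(ν) a_ν(h)` (Fourier expansion
`hasSum_fourierCoeff`, termwise differentiation of `q`-series — stub X3 `stub_qSeries_slice_deriv` —, holomorphy of slice
derivatives — stub X1 `stub_slice_deriv_holomorphic` —, and the landed `qSeriesPackage`).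
-/

set_option linter.dupNamespace false

noncomputable section

namespace Summit.Langlands.Langlands.Theorems.HilbertIntegralOverconvergentIsCongruence

open MeasureTheory Complex NumberField
open Literature.NumberTheory.Automorphic Literature.NumberTheory.Automorphic.HilbertModular
open scoped MatrixGroups

open Classical in
/-- Slices commute with real translations: `update (z + b) σ t = update z σ (t - b_σ) + b`. [folklore] -/
theorem tx_update_add {F : Type} [Field F] [NumberField F] (z : Point F) (σ : F →+* ℝ) (b : (F →+* ℝ) → ℂ)
    (t : ℂ) :
    Function.update (fun σ' ↦ z σ' + b σ') σ t = fun σ' ↦ Function.update z σ (t - b σ) σ' + b σ' := by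
  funext σ'
  by_cases h : σ' = σ
  · subst h; simp
  · simp [Function.update_of_ne h]

open Classical in
/-- Updating a coordinate of a point of `ℍ` by a value of positive imaginary part stays in `ℍ`. [folklore] -/
theorem tx_update_mem_halfSpace {F : Type} [Field F] [NumberField F] {z : Point F} (hz : z ∈ halfSpace F)
    (σ : F →+* ℝ) {t : ℂ} (ht : 0 < t.im) : Function.update z σ t ∈ halfSpace F := fun σ' ↦ by
  by_cases h : σ' = σ
  · subst h; simpa using ht
  · rw [Function.update_of_ne h]; exact hz σ'

open Classical in
/-- If two functions agree on `ℍ`, their slice derivatives agree on `ℍ` (the slices agree near the base point). [folklore] -/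
theorem tx_slice_deriv_congr {F : Type} [Field F] [NumberField F] {f g : Point F → ℂ}
    (h : ∀ z ∈ halfSpace F, f z = g z) (σ : F →+* ℝ) {z : Point F} (hz : z ∈ halfSpace F) :
    deriv (fun t : ℂ ↦ f (Function.update z σ t)) (z σ) = deriv (fun t : ℂ ↦ g (Function.update z σ t)) (z σ) := by
  refine Filter.EventuallyEq.deriv_eq ?_
  have hopen : IsOpen {t : ℂ | 0 < t.im} := isOpen_lt continuous_const Complex.continuous_im
  filter_upwards [hopen.mem_nhds (hz σ)] with t ht
  exact h _ (tx_update_mem_halfSpace hz σ ht)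

open Classical in
/-- The slice derivative of an `𝓞F`-periodic function (on `ℍ`) is `𝓞F`-periodic on `ℍ`. [folklore] -/
theorem tx_slice_deriv_periodic {F : Type} [Field F] [NumberField F] (σ : F →+* ℝ) (f : Point F → ℂ)
    (hper : ∀ (b : 𝓞 F) (z : Point F), z ∈ halfSpace F → f (fun σ' ↦ z σ' + ((σ' (b : F) : ℝ) : ℂ)) = f z) :
    ∀ (b : 𝓞 F) (z : Point F), z ∈ halfSpace F →
      deriv (fun t : ℂ ↦ f (Function.update (fun σ' ↦ z σ' + ((σ' (b : F) : ℝ) : ℂ)) σ t))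
          (z σ + ((σ (b : F) : ℝ) : ℂ)) =
        deriv (fun t : ℂ ↦ f (Function.update z σ t)) (z σ) := by
  intro b z hz
  have hopen : IsOpen {t : ℂ | 0 < t.im} := isOpen_lt continuous_const Complex.continuous_im
  -- near the base point the translated slice is the slice composed with `t ↦ t - σ(b)`
  have heq : (fun t : ℂ ↦ f (Function.update (fun σ' ↦ z σ' + ((σ' (b : F) : ℝ) : ℂ)) σ t)) =ᶠ[nhds (z σ + ((σ (b : F) : ℝ) : ℂ))]
      fun t ↦ f (Function.update z σ (t - ((σ (b : F) : ℝ) : ℂ))) := by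
    have hmem : {t : ℂ | 0 < t.im} ∈ nhds (z σ + ((σ (b : F) : ℝ) : ℂ)) :=
      hopen.mem_nhds (by simpa using hz σ)
    filter_upwards [hmem] with t ht
    rw [tx_update_add z σ (fun σ' ↦ ((σ' (b : F) : ℝ) : ℂ)) t]
    refine hper b _ (tx_update_mem_halfSpace hz σ ?_)
    simpa using ht
  rw [heq.deriv_eq]
  rw [deriv_comp_sub_const (f := fun t ↦ f (Function.update z σ t))]
  simp


open Classical in
/-- **The derivative of a Hilbert modular form in one coordinate.**  For `h ∈ M_l(Γ₁(𝔫))` over a totally real `F` and a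
place `σ`, the slice derivative `∂_σ h` is holomorphic on `ℍ`, `𝓞F`-periodic on `ℍ`, and its Fourier coefficients on the dual
lattice are `2πi σ(ν) a_ν(h)` (Fourier expansion of `h`, `hasSum_fourierCoeff`; termwise differentiation, stub X3; coefficients of
the differentiated `q`-series, `qSeriesPackage`). [folklore] -/
theorem tx_deriv_form_data (F : Type) [Field F] [NumberField F] [NumberField.IsTotallyReal F]
    (𝔫 : Ideal (𝓞 F)) (l : (F →+* ℝ) → ℤ) (σ : F →+* ℝ)
    (h : Point F → ℂ) (hh : h ∈ modularForms (Bianchi.Gamma1 𝔫) l) :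
    IsHolomorphicOn F (fun z ↦ deriv (fun t : ℂ ↦ h (Function.update z σ t)) (z σ)) ∧
    (∀ (b : 𝓞 F) (z : Point F), z ∈ halfSpace F →
      deriv (fun t : ℂ ↦ h (Function.update (fun σ' ↦ z σ' + ((σ' (b : F) : ℝ) : ℂ)) σ t))
          (z σ + ((σ (b : F) : ℝ) : ℂ)) =
        deriv (fun t : ℂ ↦ h (Function.update z σ t)) (z σ)) ∧
    (∀ μ : F, (∀ b : 𝓞 F, ∃ n : ℤ, Algebra.trace ℚ F (μ * b) = n) →
      fourierCoeff (fun z ↦ deriv (fun t : ℂ ↦ h (Function.update z σ t)) (z σ)) μ =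
        2 * Real.pi * I * ((σ μ : ℝ) : ℂ) * fourierCoeff h μ) := by
  have hhol : IsHolomorphicOn F h := (mem_modularForms_iff.mp hh).holomorphic
  have hper := stub_modularForm_periodic F 𝔫 l h hh
  refine ⟨(stub_slice_deriv_holomorphic F σ h hhol).1, fun b z hz ↦ tx_slice_deriv_periodic σ h hper b z hz, ?_⟩
  set D : Set F := {ν : F | ∀ b : 𝓞 F, ∃ n : ℤ, Algebra.trace ℚ F (ν * b) = n} with hD
  set a : F → ℂ := fun ν ↦ fourierCoeff h ν with ha
  have habs : ∀ y : (F →+* ℝ) → ℝ, (∀ σ, 0 < y σ) →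
      Summable (fun ν : D ↦ ‖a ν‖ * Real.exp (-(2 * Real.pi * ∑ σ : F →+* ℝ, σ (ν : F) * y σ))) := by
    intro y hy
    have hz : (fun σ ↦ ((y σ : ℝ) : ℂ) * I : Point F) ∈ halfSpace F := fun σ ↦ by simpa using hy σ
    have h2 := (hasSum_fourierCoeff F h hhol hper _ hz).2
    simpa using h2
  have hQ : ∀ z ∈ halfSpace F, h z = ∑' ν : D, a ν * cexp (2 * Real.pi * I * pairing (ν : F) z) :=
    fun z hz ↦ ((hasSum_fourierCoeff F h hhol hper z hz).1.tsum_eq).symm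
  obtain ⟨habs', hderiv⟩ := stub_qSeries_slice_deriv F a habs σ
  obtain ⟨-, -, hcoeff'⟩ := qSeriesPackage F (fun ν ↦ 2 * Real.pi * I * ((σ ν : ℝ) : ℂ) * a ν) habs'
  intro μ hμ
  have hDQ : ∀ z ∈ halfSpace F, deriv (fun t : ℂ ↦ h (Function.update z σ t)) (z σ) =
      ∑' ν : D, (2 * Real.pi * I * ((σ (ν : F) : ℝ) : ℂ) * a ν) * cexp (2 * Real.pi * I * pairing (ν : F) z) := by
    intro z hz
    rw [tx_slice_deriv_congr hQ σ hz]
    exact hderiv z hz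
  rw [fourierCoeff_eq, ts_fourierCoeffAt_congr hDQ μ fun _ ↦ one_pos]
  exact hcoeff' μ hμ _ fun _ ↦ one_pos


end Summit.Langlands.Langlands.Theorems.HilbertIntegralOverconvergentIsCongruence
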